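import Summits.Ventures.HodgeRepro2.T5RecordSatakeUnramified
import Summits.Ventures.HodgeRepro2.T5CMFieldSquareDatum

/-!
# The record's spherical Hecke algebra, with no auxiliary datum: the `(θ, y)`-free forms of files 231–234

Tier-5 support N3 / §G-N4.2 (seat p3, gen 77). Files 231–234 state the commutativity and the `k[X]`-structure of
the record's spherical Hecke algebra `H(U(1 ⊗ H), K_v)` on a standing datum `θ : K⁺`, `y : K` with `θ = y ^ 2`,
`complexConj K y ≠ y`, and read «non-split» as «`θ` is not a `v`-adic square». File 235
(`T5CMFieldSquareDatum.exists_sq_eq_and_complexConj_ne`) shows the datum exists for every CM field; this file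
CHOOSES it once and restates every theorem of files 233–234 with the datum gone and «non-split» read
INTRINSICALLY — «`v` has exactly one prime of `𝓞_K` above it» (`(v.asIdeal.primesOver (𝓞 K)).ncard = 1`, seat p8's
`ncard_primesOver_eq_one_iff_not_isSquare`), «split» as «two primes above `v`» (`ncard = 2`):

* `heckeAlgebra_mul_comm_record_of_staysPrime`, `nonempty_algEquiv_polynomial_record_of_staysPrime` — at every
  place `v` of `K⁺` with `v 𝓞_K = w` and `w ∉ badSet H` (file 233, datum-free);
* **`heckeAlgebra_mul_comm_record_of_ramificationIdx'_eq_one`** — at every `w ∣ v` with `e(w/v) = 1` and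
  `w ∉ badSet H` the algebra is commutative (file 234, datum-free);
* `map_eq_of_ramificationIdx'_eq_one_of_ncard_primesOver_eq_one`,
  **`nonempty_algEquiv_polynomial_record_of_ramificationIdx'_eq_one`** — unramified + one prime above `v` ⇒
  `v 𝓞_K = w` and the algebra is `k[X]`;
* `exists_finite_forall_notMem_badSet_and_map_eq_or_ncard_primesOver_eq_two` — the census, intrinsic: outside a
  finite set of places of `K⁺`, every `w ∣ v` is good for `H` and `v` stays prime or has two primes above it;
* **`exists_finite_forall_heckeAlgebra_mul_comm_record`** — there is a FINITE set `Sv` of places of `K⁺` outside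
  which `H(U(1 ⊗ H), K_v)` is commutative at every `w ∣ v`, with NO hypothesis beyond the datum of record
  (`l` generating `𝓞_K` over `𝓞_{K⁺}`, `H` a `3 × 3` hermitian invertible Gram matrix);
* **`exists_finite_forall_nonempty_algEquiv_polynomial_record`** — and `k[X]` at every `v ∉ Sv` with one prime
  above it;
* `exists_generators_and_finite_forall_heckeAlgebra_mul_comm_record` — with the generator datum `l` itself
  supplied by file 235 (`exists_fin_span_eq_top`): for every `3 × 3` hermitian invertible `H` over a CM field
  there ARE generators `l` and a finite `Sv` with `H(U(1 ⊗ H), K_v)` commutative at every `w ∣ v ∉ Sv`.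

§8(d): uses an L-value-free non-vanishing device: NO.
-/

open Matrix NumberField NumberField.IsCMField IsDedekindDomain IsDedekindDomain.HeightOneSpectrum Module
open scoped TensorProduct Pointwise
open Summit.Ventures.HodgeRepro2.T5UnitaryGroupForm Summit.Ventures.HodgeRepro2.T5UnitaryHeckeAdjoint
  Summit.Ventures.HodgeRepro2.T5HeckePermutationModule Summit.Ventures.HodgeRepro2.T5StarOfInvolution
  Summit.Ventures.HodgeRepro2.T5FinitePlaceCM Summit.Ventures.HodgeRepro2.T5FinitePlaceNormIndex
  Summit.Ventures.HodgeRepro2.T5NonSplitPlaceUnitaryGroup Summit.Ventures.HodgeRepro2.T5RecordHyperspecial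
  Summit.Ventures.HodgeRepro2.T5GlobalLatticeAlmostAll Summit.Ventures.HodgeRepro2.T5FinitePlaceSplitClassification
  Summit.Ventures.HodgeRepro2.T5RecordSatake Summit.Ventures.HodgeRepro2.T5RecordSatakeInert
  Summit.Ventures.HodgeRepro2.T5RecordSatakeUnramified Summit.Ventures.HodgeRepro2.T5FinitePlaceSplitIff
  Summit.Ventures.HodgeRepro2.T5CMFieldSquareDatum

namespace Summit.Ventures.HodgeRepro2.T5RecordSatakeIntrinsic

section Record

variable (K : Type*) [Field K] [NumberField K] [IsCMField K]
variable (v : HeightOneSpectrum (𝓞 (maximalRealSubfield K))) (w : HeightOneSpectrum (𝓞 K))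
  [w.asIdeal.LiesOver v.asIdeal]
variable {r : ℕ} (l : Fin r → 𝓞 K)

/-- **Stays prime, datum-free** (file 233's `heckeAlgebra_mul_comm_record_of_staysPrime` with the datum of file
235): if `v 𝓞_K = w` and `w ∉ badSet H`, the record's spherical Hecke algebra `H(U(1 ⊗ H), K_v)` is commutative. -/
theorem heckeAlgebra_mul_comm_record_of_staysPrime (k : Type*) [Field k]
    (hl : Submodule.span (𝓞 (maximalRealSubfield K)) (Set.range l) = ⊤)
    (hmap : Ideal.map (algebraMap (𝓞 (maximalRealSubfield K)) (𝓞 K)) v.asIdeal = w.asIdeal)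
    {H : Matrix (Fin 3) (Fin 3) K} (hH : H.IsHermitian) (hdet : IsUnit H.det) (hgood : w ∉ badSet H)
    (T S : (letI := tensorStarRing K v; ↥(heckeAlgebra k (recordHyperspecial K v l H)))) :
    T * S = S * T :=
  (exists_sq_eq_and_complexConj_ne K).elim fun _ h => h.elim fun _ h =>
    T5RecordSatakeInert.heckeAlgebra_mul_comm_record_of_staysPrime K v w h.1 h.2 hmap l k hl hH hdet hgood T S

/-- **Stays prime, datum-free, `k[X]`** (file 233's `nonempty_algEquiv_polynomial_record_of_staysPrime`). -/
theorem nonempty_algEquiv_polynomial_record_of_staysPrime (k : Type*) [Field k]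
    (hl : Submodule.span (𝓞 (maximalRealSubfield K)) (Set.range l) = ⊤)
    (hmap : Ideal.map (algebraMap (𝓞 (maximalRealSubfield K)) (𝓞 K)) v.asIdeal = w.asIdeal)
    {H : Matrix (Fin 3) (Fin 3) K} (hH : H.IsHermitian) (hdet : IsUnit H.det) (hgood : w ∉ badSet H) :
    Nonempty (Polynomial k ≃ₐ[k]
      (letI := tensorStarRing K v; ↥(heckeAlgebra k (recordHyperspecial K v l H)))) :=
  (exists_sq_eq_and_complexConj_ne K).elim fun _ h => h.elim fun _ h =>
    T5RecordSatakeInert.nonempty_algEquiv_polynomial_record_of_staysPrime K v w h.1 h.2 hmap l k hl hH hdet hgood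

/-- **THE RECORD'S SPHERICAL HECKE ALGEBRA IS COMMUTATIVE AT EVERY UNRAMIFIED GOOD PLACE, WITH NO AUXILIARY DATUM**
(file 234's `heckeAlgebra_mul_comm_record_of_ramificationIdx'_eq_one` with the datum of file 235): for the datum's
`3 × 3` hermitian invertible Gram matrix `H` over `K`, at every place `w ∣ v` with `e(w/v) = 1` and `w ∉ badSet H`,
`H(U(1 ⊗ H), K_v)` is commutative. -/
theorem heckeAlgebra_mul_comm_record_of_ramificationIdx'_eq_one (k : Type*) [Field k]
    (hl : Submodule.span (𝓞 (maximalRealSubfield K)) (Set.range l) = ⊤)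
    (he : v.asIdeal.ramificationIdx' w.asIdeal = 1)
    {H : Matrix (Fin 3) (Fin 3) K} (hH : H.IsHermitian) (hdet : IsUnit H.det) (hgood : w ∉ badSet H)
    (T S : (letI := tensorStarRing K v; ↥(heckeAlgebra k (recordHyperspecial K v l H)))) :
    T * S = S * T :=
  (exists_sq_eq_and_complexConj_ne K).elim fun _ h => h.elim fun _ h =>
    T5RecordSatakeUnramified.heckeAlgebra_mul_comm_record_of_ramificationIdx'_eq_one K v w h.1 h.2 l k hl he
      hH hdet hgood T S

/-- **Unramified + one prime above `v` ⇒ stays prime**, intrinsically (file 234's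
`map_eq_of_ramificationIdx'_eq_one_of_not_isSquare` through seat p8's `ncard_primesOver_eq_one_iff_not_isSquare`). -/
theorem map_eq_of_ramificationIdx'_eq_one_of_ncard_primesOver_eq_one
    (he : v.asIdeal.ramificationIdx' w.asIdeal = 1) (h1 : (v.asIdeal.primesOver (𝓞 K)).ncard = 1) :
    Ideal.map (algebraMap (𝓞 (maximalRealSubfield K)) (𝓞 K)) v.asIdeal = w.asIdeal :=
  (exists_sq_eq_and_complexConj_ne K).elim fun _ h => h.elim fun _ h =>
    T5RecordSatakeUnramified.map_eq_of_ramificationIdx'_eq_one_of_not_isSquare K v w h.1 h.2 he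
      ((ncard_primesOver_eq_one_iff_not_isSquare K v w h.1 h.2).mp h1)

/-- **`k[X]` at every unramified good place with one prime above it** (file 234's
`nonempty_algEquiv_polynomial_record_of_ramificationIdx'_eq_one`, «non-split» read as `ncard (primesOver v) = 1`). -/
theorem nonempty_algEquiv_polynomial_record_of_ramificationIdx'_eq_one (k : Type*) [Field k]
    (hl : Submodule.span (𝓞 (maximalRealSubfield K)) (Set.range l) = ⊤)
    (he : v.asIdeal.ramificationIdx' w.asIdeal = 1) (h1 : (v.asIdeal.primesOver (𝓞 K)).ncard = 1)
    {H : Matrix (Fin 3) (Fin 3) K} (hH : H.IsHermitian) (hdet : IsUnit H.det) (hgood : w ∉ badSet H) :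
    Nonempty (Polynomial k ≃ₐ[k]
      (letI := tensorStarRing K v; ↥(heckeAlgebra k (recordHyperspecial K v l H)))) :=
  (exists_sq_eq_and_complexConj_ne K).elim fun _ h => h.elim fun _ h =>
    T5RecordSatakeUnramified.nonempty_algEquiv_polynomial_record_of_ramificationIdx'_eq_one K v w h.1 h.2 l k hl
      he ((ncard_primesOver_eq_one_iff_not_isSquare K v w h.1 h.2).mp h1) hH hdet hgood

/-- **THE CENSUS, INTRINSIC**: for every matrix `H` over `K` there is a finite set `Sv` of places of `K⁺` such that
every place `w` of `K` over a `v ∉ Sv` is good for `H` and `v` stays prime (`v 𝓞_K = w`) or has exactly two primes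
above it (file 234's census with «split» read through seat p8's `ncard_primesOver_eq_two_iff_isSquare`). -/
theorem exists_finite_forall_notMem_badSet_and_map_eq_or_ncard_primesOver_eq_two {ι : Type*} [Fintype ι]
    [DecidableEq ι] (H : Matrix ι ι K) :
    ∃ Sv : Set (HeightOneSpectrum (𝓞 (maximalRealSubfield K))), Sv.Finite ∧
      ∀ v ∉ Sv, ∀ (w : HeightOneSpectrum (𝓞 K)) [w.asIdeal.LiesOver v.asIdeal],
        w ∉ badSet H ∧ (Ideal.map (algebraMap (𝓞 (maximalRealSubfield K)) (𝓞 K)) v.asIdeal = w.asIdeal ∨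
          (v.asIdeal.primesOver (𝓞 K)).ncard = 2) :=
  (exists_sq_eq_and_complexConj_ne K).elim fun _ h => h.elim fun _ h =>
    (exists_finite_forall_notMem_badSet_and_map_eq_or_isSquare K h.1 h.2 H).elim fun Sv hS =>
      ⟨Sv, hS.1, fun v hv w _ => ⟨(hS.2 v hv w).1, (hS.2 v hv w).2.imp id
        fun hsq => (ncard_primesOver_eq_two_iff_isSquare K v w h.1 h.2).mpr hsq⟩⟩

/-- **THE RECORD'S SPHERICAL HECKE ALGEBRA IS COMMUTATIVE AT ALL BUT FINITELY MANY PLACES, WITH NO HYPOTHESIS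
BEYOND THE DATUM OF RECORD** (file 234's `exists_finite_forall_heckeAlgebra_mul_comm_record` with the datum of file
235): for the datum's `3 × 3` hermitian invertible Gram matrix `H` over `K` and generators `l` of `𝓞_K` over
`𝓞_{K⁺}` there is a finite set `Sv` of places of `K⁺` such that at every `v ∉ Sv` and every place `w` of `K` over
`v`, `H(U(1 ⊗ H), K_v)` is commutative. -/
theorem exists_finite_forall_heckeAlgebra_mul_comm_record (k : Type*) [Field k]
    (hl : Submodule.span (𝓞 (maximalRealSubfield K)) (Set.range l) = ⊤)
    {H : Matrix (Fin 3) (Fin 3) K} (hH : H.IsHermitian) (hdet : IsUnit H.det) :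
    ∃ Sv : Set (HeightOneSpectrum (𝓞 (maximalRealSubfield K))), Sv.Finite ∧
      ∀ v ∉ Sv, ∀ (w : HeightOneSpectrum (𝓞 K)) [w.asIdeal.LiesOver v.asIdeal],
        ∀ T S : (letI := tensorStarRing K v; ↥(heckeAlgebra k (recordHyperspecial K v l H))), T * S = S * T :=
  (exists_sq_eq_and_complexConj_ne K).elim fun _ h => h.elim fun _ h =>
    T5RecordSatakeUnramified.exists_finite_forall_heckeAlgebra_mul_comm_record K h.1 h.2 l k hl hH hdet

/-- **`k[X]` AT ALL BUT FINITELY MANY PLACES WITH ONE PRIME ABOVE THEM** (file 234's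
`exists_finite_forall_nonempty_algEquiv_polynomial_record`, «non-split» read as `ncard (primesOver v) = 1`). -/
theorem exists_finite_forall_nonempty_algEquiv_polynomial_record (k : Type*) [Field k]
    (hl : Submodule.span (𝓞 (maximalRealSubfield K)) (Set.range l) = ⊤)
    {H : Matrix (Fin 3) (Fin 3) K} (hH : H.IsHermitian) (hdet : IsUnit H.det) :
    ∃ Sv : Set (HeightOneSpectrum (𝓞 (maximalRealSubfield K))), Sv.Finite ∧
      ∀ v ∉ Sv, ∀ (w : HeightOneSpectrum (𝓞 K)) [w.asIdeal.LiesOver v.asIdeal],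
        (v.asIdeal.primesOver (𝓞 K)).ncard = 1 →
        Nonempty (Polynomial k ≃ₐ[k]
          (letI := tensorStarRing K v; ↥(heckeAlgebra k (recordHyperspecial K v l H)))) :=
  (exists_sq_eq_and_complexConj_ne K).elim fun _ h => h.elim fun _ h =>
    (T5RecordSatakeUnramified.exists_finite_forall_nonempty_algEquiv_polynomial_record K h.1 h.2 l k hl hH
      hdet).elim fun Sv hS =>
      ⟨Sv, hS.1, fun v hv w _ h1 => hS.2 v hv w ((ncard_primesOver_eq_one_iff_not_isSquare K v w h.1 h.2).mp h1)⟩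

end Record

section Generators

variable (K : Type*) [Field K] [NumberField K] [IsCMField K]

/-- **With the generator datum supplied as well** (file 235's `exists_fin_span_eq_top`): for every `3 × 3`
hermitian invertible `H` over a CM field `K` there are generators `l` of `𝓞_K` over `𝓞_{K⁺}` and a finite set `Sv`
of places of `K⁺` such that `H(U(1 ⊗ H), K_v)` (the record's pair built on `l`) is commutative at every `v ∉ Sv`
and every `w ∣ v`. -/
theorem exists_generators_and_finite_forall_heckeAlgebra_mul_comm_record (k : Type*) [Field k]
    {H : Matrix (Fin 3) (Fin 3) K} (hH : H.IsHermitian) (hdet : IsUnit H.det) :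
    ∃ (r : ℕ) (l : Fin r → 𝓞 K), Submodule.span (𝓞 (maximalRealSubfield K)) (Set.range l) = ⊤ ∧
      ∃ Sv : Set (HeightOneSpectrum (𝓞 (maximalRealSubfield K))), Sv.Finite ∧
        ∀ v ∉ Sv, ∀ (w : HeightOneSpectrum (𝓞 K)) [w.asIdeal.LiesOver v.asIdeal],
          ∀ T S : (letI := tensorStarRing K v; ↥(heckeAlgebra k (recordHyperspecial K v l H))), T * S = S * T :=
  (exists_fin_span_eq_top K).elim fun r h => h.elim fun l hl =>
    ⟨r, l, hl, exists_finite_forall_heckeAlgebra_mul_comm_record K l k hl hH hdet⟩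

end Generators

end Summit.Ventures.HodgeRepro2.T5RecordSatakeIntrinsic
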